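import Summits.RiemannHypothesis.RiemannHypothesis.Theorems.SuzukiStructureFunctionsPhiTimeDerivative
import Mathlib.MeasureTheory.Integral.IntervalIntegral.IntegrationByParts
import Mathlib.Analysis.Calculus.ParametricIntegral
import HarnessLib

/-!
# SuzukiStructureFunctionsPhiSpaceDerivative — Lemma 3.5 (`∂_xφ^ε(t,x)` for `K ∈ C¹`), Suzuki's (3.21), and
# uniqueness of the window equation in pointwise form (column DBR; RH-FREE)

LINE 1 — LABEL: RH-FREE (calculus + Fredholm uniqueness on `L²(ℝ)` for ANY `C¹` kernel vanishing on `(−∞,0]`; no `ζ`,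
no zeros, no positivity); bears_on LADDER-RH B-D → B-P(P1)/(P3): the `x`-regularity input (Lemma 3.5) and the
differentiated equation (3.21) of §3.5, plus the uniqueness step («by the uniqueness of solutions (Lemmas 3.3 and
3.4)») by which (3.20) and (3.21) combine to (3.24) — see …PhiSystem.
WHAT THIS IS NOT: not progress toward RH; nothing is claimed for kernels that are only piecewise `C¹` ((K4), `Λ ≠ ∅`).

Source: M. Suzuki, J. Funct. Anal. 281 (2021) 109116 = arXiv:1606.05726 [Suzuki2021Hamiltonians], §3.4 Lemma 3.5,
§3.5 eq. (3.21), Lemmas 3.3/3.4.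

Contents (seat rh-dbr-eng-5 g7): `setIntegral_Ioo_eq_intervalIntegral`, `memLp_window_of_continuous`,
**`eq_zero_of_window_eq_zero`** (uniqueness, pointwise form, `L²` hypothesis), **`hasDerivAt_suzukiPhiExt_space`**
(Lemma 3.5), `continuous_deriv_suzukiPhiExt_space`, **`deriv_space_window_eq`** ((3.21)).
-/

noncomputable section

-- D-0017: `Summit.<S>.<S>.…` is the designed namespace of a single-problem summit.
set_option linter.dupNamespace false

open MeasureTheory Set Filter Topology Function
open scoped ENNReal RealInnerProductSpace

namespace Summit.RiemannHypothesis.RiemannHypothesis.Theorems.SuzukiStructureFunctions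

open Literature.Analysis.OperatorTheory Literature.NumberTheory.LFunctions
  Literature.NumberTheory.LFunctions.SuzukiStructure
open Summit.RiemannHypothesis.RiemannHypothesis.Theorems.SuzukiPhiExistence
  (continuous_suzukiPhiExt setIntegral_Iic_kernel_mul_suzukiPhiExt_eq exists_isSuzukiPhiSolution_of_noUnitEigenvalue)

variable {K : ℝ → ℝ} {ε t : ℝ}

/-! ## §25 Lemma 3.5 (`x`-differentiability of `φ^ε(t,·)`), Suzuki's (3.21), and uniqueness on clean windows
(pointwise form) — for `K ∈ C¹` vanishing on `(−∞,0]` -/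

/-- RH-FREE. Window set integrals as interval integrals (`t ≥ 0`). -/
theorem setIntegral_Ioo_eq_intervalIntegral (ht : 0 ≤ t) (f : ℝ → ℝ) :
    ∫ y in Ioo (-t) t, f y = ∫ y in (-t)..t, f y := by
  rw [intervalIntegral.integral_of_le (by linarith), setIntegral_congr_set (Ioo_ae_eq_Ioc (μ := volume))]

/-- RH-FREE. Continuous functions are square-integrable on the windows `(−t,t)`. -/
theorem memLp_window_of_continuous {f : ℝ → ℝ} (hf : Continuous f) (t : ℝ) :
    MemLp f 2 (volume.restrict (Ioo (-t) t)) := by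
  haveI : IsFiniteMeasure (volume.restrict (Ioo (-t) t)) :=
    ⟨by rw [Measure.restrict_apply_univ]; exact measure_Ioo_lt_top⟩
  obtain ⟨C, hC⟩ : ∃ C, ∀ u ∈ Icc (-t) t, ‖f u‖ ≤ C := isCompact_Icc.exists_bound_of_continuousOn hf.continuousOn
  refine MemLp.of_bound hf.aestronglyMeasurable C ?_
  rw [ae_restrict_iff' measurableSet_Ioo]
  exact Eventually.of_forall fun y hy => hC y (Ioo_subset_Icc_self hy)

/-- RH-FREE. **Uniqueness on a clean window, pointwise form (Lemmas 3.3/3.4):** a function `h`, square-integrable on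
`(−t,t)`, with `h(x) + ε∫_{(−t,t)}K(x+y)h(y)dy = 0` for ALL real `x`, vanishes identically (`1 + ε𝖪[t]` is a unit on
`L²(ℝ)`, so `h = 0` a.e. on the window, whence the window integral vanishes for every `x`). -/
theorem eq_zero_of_window_eq_zero (hKc : Continuous K) (hε : ε = 1 ∨ ε = -1) (hN : NoUnitEigenvalue K t)
    {h : ℝ → ℝ} (hh : MemLp h 2 (volume.restrict (Ioo (-t) t)))
    (heq : ∀ x : ℝ, h x + ε * ∫ y in Ioo (-t) t, K (x + y) * h y = 0) (x : ℝ) : h x = 0 := by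
  set U : Lp ℝ 2 (volume : Measure ℝ) →L[ℝ] Lp ℝ 2 (volume : Measure ℝ) := 1 + ε • winOpL2 K hKc t with hU
  have hUu : IsUnit U := isUnit_one_add_smul_winOpL2 hKc hε hN
  have hfI : MemLp ((Ioo (-t) t).indicator h) 2 (volume : Measure ℝ) :=
    (memLp_indicator_iff_restrict measurableSet_Ioo).2 hh
  set v : Lp ℝ 2 (volume : Measure ℝ) := hfI.toLp _ with hv
  have hv_ae : (v : ℝ → ℝ) =ᵐ[volume] (Ioo (-t) t).indicator h := MemLp.coeFn_toLp _
  have hpts : ∀ᵐ x ∂(volume : Measure ℝ), x ≠ -t ∧ x ≠ t := by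
    have e1 : ({-t}ᶜ : Set ℝ) ∈ ae (volume : Measure ℝ) := compl_mem_ae_iff.mpr (measure_singleton _)
    have e2 : ({t}ᶜ : Set ℝ) ∈ ae (volume : Measure ℝ) := compl_mem_ae_iff.mpr (measure_singleton _)
    filter_upwards [e1, e2] with x hx1 hx2
    exact ⟨hx1, hx2⟩
  have hUv : U v = 0 := by
    apply Lp.ext
    have e : U v = v + ε • winOpL2 K hKc t v := by simp [hU]
    rw [e]
    filter_upwards [Lp.coeFn_add v (ε • winOpL2 K hKc t v), Lp.coeFn_smul ε (winOpL2 K hKc t v),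
      winOpL2_spec hKc t v, hv_ae, Lp.coeFn_zero ℝ 2 (volume : Measure ℝ), hpts] with x hx1 hx2 hx3 hx4 hx5 hx6
    rw [hx1, Pi.add_apply, hx2, Pi.smul_apply, smul_eq_mul, hx3, hx5, Pi.zero_apply]
    have hint : ∫ y, winKer K t x y * (v : ℝ → ℝ) y = ∫ y, winKer K t x y * (Ioo (-t) t).indicator h y :=
      integral_congr_ae (by filter_upwards [hv_ae] with y hy; rw [hy])
    rw [hint, hx4]
    by_cases hx : x ∈ Ioo (-t) t
    · rw [indicator_of_mem hx, integral_winKer_mul_eq_setIntegral K (Ioo_subset_Icc_self hx)]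
      have hIoo : ∫ y in Ioo (-t) t, K (x + y) * (Ioo (-t) t).indicator h y = ∫ y in Ioo (-t) t, K (x + y) * h y :=
        setIntegral_congr_fun measurableSet_Ioo fun y hy => by rw [indicator_of_mem hy]
      rw [hIoo]
      exact heq x
    · have hxI : x ∉ Icc (-t) t := fun h' => hx ⟨lt_of_le_of_ne h'.1 (Ne.symm hx6.1), lt_of_le_of_ne h'.2 hx6.2⟩
      rw [indicator_of_notMem hx, integral_winKer_mul_eq_zero K hxI]; ring
  have hv0 : v = 0 := by
    have h1 : (Ring.inverse U * U) v = Ring.inverse U 0 := congrArg (fun z => Ring.inverse U z) hUv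
    rw [Ring.inverse_mul_cancel _ hUu, map_zero] at h1
    simpa using h1
  have hind : (Ioo (-t) t).indicator h =ᵐ[volume] (0 : ℝ → ℝ) := by
    have h0 : ((0 : Lp ℝ 2 (volume : Measure ℝ)) : ℝ → ℝ) =ᵐ[volume] 0 := Lp.coeFn_zero _ _ _
    rw [← hv0] at h0
    exact hv_ae.symm.trans h0
  have hI : ∫ y in Ioo (-t) t, K (x + y) * h y = 0 := by
    have hae : ∀ᵐ y ∂(volume.restrict (Ioo (-t) t)), K (x + y) * h y = (0 : ℝ → ℝ) y := by
      rw [ae_restrict_iff' measurableSet_Ioo]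
      filter_upwards [hind] with y hy hyI
      have h0 : h y = 0 := by
        have h' := hy
        rw [indicator_of_mem hyI] at h'
        exact h'
      rw [h0, mul_zero, Pi.zero_apply]
    exact integral_eq_zero_of_ae hae
  have h2 := heq x
  rw [hI, mul_zero, add_zero] at h2
  exact h2

/-- **RH-FREE · LEMMA 3.5 for `K ∈ C¹` (vanishing on `(−∞,0]`):** at a time `t` where (3.4) is solvable,
`x ↦ φ^ε(t,x)` is differentiable at every `x₀` with
`∂_xφ^ε(t,x₀) = K′(x₀+t) − ε∫_{(−t,t)}K′(x₀+y)φ^ε(t,y)dy` (differentiation under the window integral). -/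
theorem hasDerivAt_suzukiPhiExt_space (hKd : ContDiff ℝ 1 K) (hK0 : ∀ u : ℝ, u ≤ 0 → K u = 0)
    (hsol : ∃ X, IsSuzukiPhiSolution K ε t X) (x₀ : ℝ) :
    HasDerivAt (suzukiPhiExt K ε t)
      (deriv K (x₀ + t) - ε * ∫ y in Ioo (-t) t, deriv K (x₀ + y) * suzukiPhiExt K ε t y) x₀ := by
  have hKc : Continuous K := hKd.continuous
  have hK' : Continuous (deriv K) := hKd.continuous_deriv le_rfl
  have hdiff : ∀ u : ℝ, HasDerivAt K (deriv K u) u := fun u => (hKd.differentiable one_ne_zero u).hasDerivAt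
  have hK3 : ∀ u : ℝ, u < 0 → K u = 0 := fun u hu => hK0 u hu.le
  set φ := suzukiPhiExt K ε t with hφdef
  have hφ : Continuous φ := continuous_suzukiPhiExt hKc hK3 ε t
  -- bounds on the compact pieces
  obtain ⟨C₁, hC₁⟩ : ∃ C, ∀ u ∈ Icc (-(|x₀| + 1 + |t|)) (|x₀| + 1 + |t|), ‖deriv K u‖ ≤ C :=
    isCompact_Icc.exists_bound_of_continuousOn hK'.continuousOn
  obtain ⟨C₂, hC₂⟩ : ∃ C, ∀ u ∈ Icc (-t) t, ‖φ u‖ ≤ C := isCompact_Icc.exists_bound_of_continuousOn hφ.continuousOn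
  have hC₁0 : 0 ≤ C₁ := (norm_nonneg _).trans (hC₁ 0 ⟨by linarith [abs_nonneg x₀, abs_nonneg t],
    by linarith [abs_nonneg x₀, abs_nonneg t]⟩)
  -- derivative of the window integral under the integral sign
  have hint : HasDerivAt (fun x : ℝ => ∫ y in Ioo (-t) t, K (x + y) * φ y)
      (∫ y in Ioo (-t) t, deriv K (x₀ + y) * φ y) x₀ := by
    have h := hasDerivAt_integral_of_dominated_loc_of_deriv_le (μ := volume.restrict (Ioo (-t) t))
      (F := fun x y : ℝ => K (x + y) * φ y) (F' := fun x y : ℝ => deriv K (x + y) * φ y) (x₀ := x₀)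
      (bound := fun _ : ℝ => C₁ * C₂) (s := Metric.ball x₀ 1) (Metric.ball_mem_nhds x₀ one_pos)
      (Eventually.of_forall fun x =>
        (((hKc.comp (continuous_const.add continuous_id)).mul hφ : Continuous fun y : ℝ => K (x + y) * φ y)
          |>.aestronglyMeasurable))
      (((hKc.comp (continuous_const.add continuous_id)).mul hφ : Continuous fun y : ℝ => K (x₀ + y) * φ y)
        |>.integrableOn_Icc.mono_set Ioo_subset_Icc_self)
      (((hK'.comp (continuous_const.add continuous_id)).mul hφ : Continuous fun y : ℝ => deriv K (x₀ + y) * φ y)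
        |>.aestronglyMeasurable) ?_
      ((continuous_const.integrableOn_Icc (a := -t) (b := t)).mono_set Ioo_subset_Icc_self) ?_
    · exact h.2
    · rw [ae_restrict_iff' measurableSet_Ioo]
      refine Eventually.of_forall fun y hy x hx => ?_
      have hx' : |x - x₀| < 1 := by rw [← Real.dist_eq]; exact hx
      have hxy : x + y ∈ Icc (-(|x₀| + 1 + |t|)) (|x₀| + 1 + |t|) := by
        have h1 := abs_lt.1 hx'
        have h2 := hy.1; have h3 := hy.2
        constructor <;> nlinarith [abs_nonneg x₀, abs_nonneg t, le_abs_self x₀, neg_abs_le x₀, le_abs_self t,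
          neg_abs_le t]
      rw [norm_mul]
      exact mul_le_mul (hC₁ _ hxy) (hC₂ y (Ioo_subset_Icc_self hy)) (norm_nonneg _) hC₁0
    · exact Eventually.of_forall fun y x _ =>
        ((hdiff (x + y)).comp x ((hasDerivAt_id x).add_const y) |>.congr_deriv (by simp)).mul_const (φ y)
  have hmain : HasDerivAt (fun x : ℝ => K (x + t) - ε * ∫ y in Ioo (-t) t, K (x + y) * φ y)
      (deriv K (x₀ + t) - ε * ∫ y in Ioo (-t) t, deriv K (x₀ + y) * φ y) x₀ :=
    (((hdiff (x₀ + t)).comp x₀ ((hasDerivAt_id x₀).add_const t)).congr_deriv (by simp)).sub (hint.const_mul ε)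
  refine hmain.congr_of_eventuallyEq (Eventually.of_forall fun x => ?_)
  show suzukiPhiExt K ε t x = K (x + t) - ε * ∫ y in Ioo (-t) t, K (x + y) * suzukiPhiExt K ε t y
  rw [← setIntegral_Iic_kernel_mul_suzukiPhiExt_eq hK3 ε t x]
  exact suzukiPhiExt_eq hsol x

/-- RH-FREE. The `x`-derivative `∂_xφ^ε(t,·)` is continuous (`K ∈ C¹`; `t ≥ 0`). -/
theorem continuous_deriv_suzukiPhiExt_space (hKd : ContDiff ℝ 1 K) (hK0 : ∀ u : ℝ, u ≤ 0 → K u = 0)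
    (hsol : ∃ X, IsSuzukiPhiSolution K ε t X) (ht : 0 ≤ t) :
    Continuous (deriv (suzukiPhiExt K ε t)) := by
  have hKc : Continuous K := hKd.continuous
  have hK' : Continuous (deriv K) := hKd.continuous_deriv le_rfl
  have hφ : Continuous (suzukiPhiExt K ε t) := continuous_suzukiPhiExt hKc (fun u hu => hK0 u hu.le) ε t
  have e : deriv (suzukiPhiExt K ε t) = fun x => deriv K (x + t) -
      ε * ∫ y in (-t)..t, deriv K (x + y) * suzukiPhiExt K ε t y := by
    funext x
    rw [(hasDerivAt_suzukiPhiExt_space hKd hK0 hsol x).deriv, setIntegral_Ioo_eq_intervalIntegral ht]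
  rw [e]
  have hF : Continuous (uncurry fun x y : ℝ => deriv K (x + y) * suzukiPhiExt K ε t y) :=
    (hK'.comp (continuous_fst.add continuous_snd)).mul (hφ.comp continuous_snd)
  exact (hK'.comp (continuous_id.add continuous_const)).sub
    (continuous_const.mul (intervalIntegral.continuous_parametric_intervalIntegral_of_continuous' hF (-t) t))

/-- **RH-FREE · Suzuki's (3.21):** for `K ∈ C¹` vanishing on `(−∞,0]` and `t ≥ 0` with (3.4) solvable,
`∂_xφ^ε(t,x) − ε∫_{(−t,t)}K(x+y)∂_yφ^ε(t,y)dy = K′(x+t) − εφ^ε(t,t)K(x+t)` (differentiate (3.8) in `x`, then integrate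
by parts on `[−t,t]`, using `φ^ε(t,−t) = 0`). -/
theorem deriv_space_window_eq (hKd : ContDiff ℝ 1 K) (hK0 : ∀ u : ℝ, u ≤ 0 → K u = 0)
    (hsol : ∃ X, IsSuzukiPhiSolution K ε t X) (ht : 0 ≤ t) (x : ℝ) :
    deriv (suzukiPhiExt K ε t) x - ε * ∫ y in Ioo (-t) t, K (x + y) * deriv (suzukiPhiExt K ε t) y =
      deriv K (x + t) - ε * suzukiPhiExt K ε t t * K (x + t) := by
  have hKc : Continuous K := hKd.continuous
  have hK' : Continuous (deriv K) := hKd.continuous_deriv le_rfl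
  have hdiff : ∀ u : ℝ, HasDerivAt K (deriv K u) u := fun u => (hKd.differentiable one_ne_zero u).hasDerivAt
  have hK3 : ∀ u : ℝ, u < 0 → K u = 0 := fun u hu => hK0 u hu.le
  set φ := suzukiPhiExt K ε t with hφdef
  have hφ : Continuous φ := continuous_suzukiPhiExt hKc hK3 ε t
  have hdφ : ∀ y : ℝ, HasDerivAt φ (deriv φ y) y := fun y =>
    (hasDerivAt_suzukiPhiExt_space hKd hK0 hsol y).differentiableAt.hasDerivAt
  have hdφc : Continuous (deriv φ) := continuous_deriv_suzukiPhiExt_space hKd hK0 hsol ht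
  -- integration by parts on `[−t,t]`
  have hparts := intervalIntegral.integral_mul_deriv_eq_deriv_mul (a := -t) (b := t)
    (u := fun y : ℝ => K (x + y)) (u' := fun y : ℝ => deriv K (x + y)) (v := φ) (v' := deriv φ)
    (fun y _ => ((hdiff (x + y)).comp y ((hasDerivAt_id y).const_add x)).congr_deriv (by simp))
    (fun y _ => hdφ y) ((hK'.comp (continuous_const.add continuous_id)).intervalIntegrable _ _)
    (hdφc.intervalIntegrable _ _)
  -- `φ(t,−t) = 0`
  have hneg : φ (-t) = 0 := suzukiPhiExt_neg_self hK0 hsol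
  rw [(hasDerivAt_suzukiPhiExt_space hKd hK0 hsol x).deriv, setIntegral_Ioo_eq_intervalIntegral ht,
    setIntegral_Ioo_eq_intervalIntegral ht, hparts, hneg, show x + -t = x - t by ring]
  have ecomm : ∫ y in (-t)..t, deriv K (x + y) * φ y = ∫ y in (-t)..t, deriv K (x + y) * suzukiPhiExt K ε t y := rfl
  ring

end Summit.RiemannHypothesis.RiemannHypothesis.Theorems.SuzukiStructureFunctions
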